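import Summits.Ventures.WeilGRH.BaseRungOddTransfer
import Summits.Ventures.WeilGRH.MinorantZetaTransferOddRungs
import Literature.NumberTheory.LFunctions.QuadraticCharacterShiftSumsPrimePow
import HarnessLib

/-!
# GRH arm (rh-explicit, venture WeilGRH): the base rung `(log 2)/2` is COMPLETE — Yoshida's window for every
  Dirichlet `L`-function

Cell `rh-explicit`, WEIL TRACK — GRH ARM (weil-grh-2 gen7).  H. Yoshida (1992) proved Weil positivity for `ζ` on the
window `[-(log 2)/2, (log 2)/2]` (tree: `weilPositivityOn_log_two_half_holds`); the GRH arm's base rung is the same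
window for `L(s, χ)`.  The tree already holds it for every character of every modulus `q ≥ 5`
(`weilPositivityOnChar_log_two_half`, even transfer + odd transfer, weil-grh-2/weil-grh-1) and, by the odd `ζ`-transfer
floor law, for every ODD character of every modulus `q ≥ 3` (`weilPositivityOnChar_log_two_half_of_odd_ge`).  This file
closes the bookkeeping: at modulus `3` and `4` the unit group is `{±1}`, so a character `χ ≠ 1` is odd; hence

* ★ `weilPositivityOnChar_log_two_half_of_ne_one : 3 ≤ q → χ ≠ 1 → WeilPositivityOnChar χ ((log 2)/2)` — the base
  rung for EVERY non-principal Dirichlet character of EVERY modulus (the principal characters mod `3`, `4` are the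
  only characters of modulus `≥ 3` not covered: their form is the all-trivial even pseudo-key of level `log 3`,
  `log 4`, below the certified even pseudo-key floor `4` of the window — cell data, deposit trivial-key-minorant-CERT);
* ★★ `weilPositivityOnChar_log_two_half_of_isPrimitive : χ.IsPrimitive → WeilPositivityOnChar χ ((log 2)/2)` for
  EVERY modulus `q ≥ 1` — i.e. **Yoshida's window `(log 2)/2` of Weil's criterion holds for every primitive
  Dirichlet character, `ζ` included** (`q = 1`: Yoshida's theorem itself via `weilPositivityOnChar_modOne_iff`;
  `q = 2` has no primitive character; `q ≥ 3`: the previous item);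
* `…_of_le_…` versions for every window `a ≤ (log 2)/2`.

No new analysis: assembly of tree theorems plus the finite group facts `(ℤ/3)ˣ = (ℤ/4)ˣ = {±1}`, `(ℤ/2)ˣ = {1}`
(`decide`) and `Literature.NumberTheory.LFunctions.ne_one_of_isPrimitive` (the modulus-2 case is also
`Literature.Barriers.Parity.MMSmoothing.not_isPrimitive_level_two`, not imported to keep this file's closure small).
Everything is PROVED; no definitions, no named facts; RH/GRH-free (each rung is ONE window of Weil's criterion,
necessary for `GRH(χ)`).  References: H. Yoshida (1992) [Yoshida1992]; A. Weil (1952), the «lemme» p. 262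
[Weil1952FormulesExplicites].
-/

set_option autoImplicit false

noncomputable section

open Complex Set

namespace Summit.Ventures.WeilGRH

open Literature.NumberTheory.LFunctions

variable {q : ℕ}

/-! ## Small unit groups -/

/-- If the unit group of `ℤ/q` is `{±1}`, a Dirichlet character `χ ≠ 1` mod `q` is odd. [folklore] -/
theorem odd_of_ne_one_of_units [NeZero q] (hU : ∀ u : (ZMod q)ˣ, u = 1 ∨ u = -1)
    {χ : DirichletCharacter ℂ q} (hχ : χ ≠ 1) : χ.Odd := by
  rcases χ.even_or_odd with heven | hodd
  · exfalso
    apply hχ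
    ext u
    rcases hU u with rfl | rfl
    · simp
    · rw [MulChar.one_apply_coe, Units.val_neg, Units.val_one]
      exact heven
  · exact hodd

/-- A non-principal character mod `3` or mod `4` is odd (`(ℤ/3)ˣ = (ℤ/4)ˣ = {±1}`, by `decide`). [folklore] -/
theorem odd_of_ne_one_of_le_four [NeZero q] (hq3 : 3 ≤ q) (hq4 : q ≤ 4) {χ : DirichletCharacter ℂ q}
    (hχ : χ ≠ 1) : χ.Odd := by
  obtain rfl | rfl : q = 3 ∨ q = 4 := by omega
  · exact odd_of_ne_one_of_units (by decide) hχ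
  · exact odd_of_ne_one_of_units (by decide) hχ

/-! ## The complete base rung -/

/-- ★ **The base rung `(log 2)/2` for EVERY non-principal Dirichlet character of EVERY modulus `q ≥ 3`.** [folklore] -/
theorem weilPositivityOnChar_log_two_half_of_ne_one (hq : 3 ≤ q) (χ : DirichletCharacter ℂ q) (hχ : χ ≠ 1) :
    WeilPositivityOnChar χ (Real.log 2 / 2) := by
  by_cases h5 : 5 ≤ q
  · exact weilPositivityOnChar_log_two_half h5 χ
  · haveI : NeZero q := ⟨by omega⟩
    have hodd : χ.Odd := odd_of_ne_one_of_le_four hq (by omega) hχ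
    exact weilPositivityOnChar_log_two_half_of_odd_ge hq χ (charParity_of_odd hodd)

/-- Every window `a ≤ (log 2)/2` for every non-principal character of every modulus `q ≥ 3`. [folklore] -/
theorem weilPositivityOnChar_of_le_log_two_half_of_ne_one (hq : 3 ≤ q) (χ : DirichletCharacter ℂ q) (hχ : χ ≠ 1)
    {a : ℝ} (ha : a ≤ Real.log 2 / 2) : WeilPositivityOnChar χ a :=
  (weilPositivityOnChar_log_two_half_of_ne_one hq χ hχ).mono ha

/-- ★★ **Yoshida's window for every Dirichlet `L`-function**: the base rung `(log 2)/2` of Weil's criterion holds for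
EVERY primitive Dirichlet character of EVERY modulus `q ≥ 1` (`q = 1`: `ζ`, Yoshida 1992, `weilPositivityOn_log_two_half_holds`).
[cite: Yoshida1992, Theorem (the window (log 2)/2 for ζ); Weil1952FormulesExplicites, the «lemme» p. 262] -/
theorem weilPositivityOnChar_log_two_half_of_isPrimitive [NeZero q] (χ : DirichletCharacter ℂ q)
    (hχ : χ.IsPrimitive) : WeilPositivityOnChar χ (Real.log 2 / 2) := by
  by_cases h3 : 3 ≤ q
  · exact weilPositivityOnChar_log_two_half_of_ne_one h3 χ (ne_one_of_isPrimitive (by omega) hχ)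
  · have hq0 : q ≠ 0 := NeZero.ne q
    obtain rfl | rfl : q = 1 ∨ q = 2 := by omega
    · exact (weilPositivityOnChar_modOne_iff χ _).2 weilPositivityOn_log_two_half_holds
    · -- modulus 2: `(ℤ/2)ˣ = {1}`, so `χ = 1`, which is not primitive (conductor 1)
      have h1 : χ = 1 := by
        ext u
        obtain rfl : u = 1 := by revert u; decide
        simp
      exact absurd h1 (ne_one_of_isPrimitive (by norm_num) hχ)

/-- Every window `a ≤ (log 2)/2` for every primitive Dirichlet character of every modulus. [folklore] -/
theorem weilPositivityOnChar_of_le_log_two_half_of_isPrimitive [NeZero q] (χ : DirichletCharacter ℂ q)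
    (hχ : χ.IsPrimitive) {a : ℝ} (ha : a ≤ Real.log 2 / 2) : WeilPositivityOnChar χ a :=
  (weilPositivityOnChar_log_two_half_of_isPrimitive χ hχ).mono ha

end Summit.Ventures.WeilGRH

end
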